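import Summits.AtomisticToContinuum.Crystallization.Theorems.PalmUnimodularRigidityBenjaminiSchrammLimit
import Summits.AtomisticToContinuum.Crystallization.Theorems.MinimiserShells.Negative.LoadBearing
import Literature.Probability.Process.PointStationaryLaw
import Literature.Probability.Process.LocallyMatches

/-!
# The Benjamini–Schramm limit of a hard-core sequence, with the closed-set portmanteau bound (stub N1, reshape r6)

Stub `stub_necessity_limit` (N1, necessity sandwich) of line `equilibrium-in-law-surgery` (reshape r6)
of crux `MinimiserShells` (stmt-AtomisticToContinuum-9225, route `PalmUnimodularRigidity`).

This is the construction of item `stmt-AtomisticToContinuum-9230`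
(`BenjaminiSchrammLimit.exists_limit`, file `PalmUnimodularRigidityBenjaminiSchrammLimit`) for an
ARBITRARY sequence of finite injective `δ`-separated configurations `y n : Fin (M n) → ℝ³`
(`0 < M n`) instead of a sequence of ground states (whose ground-state hypothesis is used there only
for injectivity and for `𝓔 = E(N)`): a subsequence `φ` and a probability law `P` on configurations,
almost surely rooted `δ`-hard-core, point-stationary (exact finite mass transport
`map_reroot_compProd_emp` passes to the weak limit, `map_reroot_compProd_eq_of_tendsto`,
`isPointStationaryLaw_map_toMeasure`), with mean root energy the limit of `𝓔(y (φ j)) / M (φ j)`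
(`integral_rootEnergy_emp` and the continuity of the root energy on the compact configuration
space, `continuous_integral_lennardJones_toMeasure`), together with the CLOSED-SET half of the
portmanteau theorem in density form: for every set `T` of configurations that is closed under local
approximation within the hard-core class and every `ρ > P(T)`, eventually at most `ρ · M (φ j)`
particles of `y (φ j)` have their re-rooted configuration `count|((· - yᵢ) '' range y)` in `T`.

Proof of the last clause.  The preimage `F = e ⁻¹' T` of `T` under the counting-measure map
`e : S ↦ count|S` on the compact metric space of rooted `δ`-hard-core configurations is closed: it is
sequentially closed, because convergence in the local rubber topology is eventual local matching at
every scale (`LocalConfig.tendsto_iff_locallyMatches`) and `T` is closed under such approximation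
(`isClosed_preimage_toMeasure`).  By the portmanteau theorem
(`ProbabilityMeasure.limsup_measure_closed_le_of_tendsto`) `limsup_j P_j(F) ≤ Q(F) = P(T) < ρ`, so
eventually `P_j(F) < ρ`, and `P_j(F) = #{i | y (φ j) seen from i ∈ T} / M (φ j)` (`emp_apply`,
`RootedHardCoreConfig.toMeasure_ofFinite`).

The general-`δ` statement is `exists_limit_general`; the registered stub is its instance `δ = 1/3`.
-/

noncomputable section

open MeasureTheory Set Filter Metric TopologicalSpace ProbabilityTheory
open scoped Topology ENNReal NNReal Classical BoundedContinuousFunction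

namespace Summit.AtomisticToContinuum.Crystallization.Theorems.PalmUnimodularRigidityMinimiserShells.NecessityLimit

open Literature.Probability.Process Literature.Probability.Process.LocalConfig
open Literature.MathematicalPhysics.StatisticalMechanics
open Summit.AtomisticToContinuum.Crystallization.Theorems.MinimiserShells.Negative.LoadBearing (meanRootEnergy)
open Summit.AtomisticToContinuum.Crystallization.Theorems.BenjaminiSchrammLimit

/-- `ℝ³`. -/
local notation "E3" => EuclideanSpace ℝ (Fin 3)

variable {δ : ℝ}

-- adapted from `BenjaminiSchrammLimit.exists_limit` (Theorems/PalmUnimodularRigidityBenjaminiSchrammLimit.lean):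
-- the three local notations are copied verbatim so that the template's public lemmas apply.
set_option quotPrecheck false in
/-- The re-rooting involution `Θ (S, y) = (S - y, -y)` of the Campbell measure. -/
local notation "Θ" => fun p : RootedHardCoreConfig E3 δ × E3 =>
  ((if h : p.2 ∈ ((p.1.1 : LocalConfig E3) : Set E3) then p.1.reroot p.2 h else p.1 :
    RootedHardCoreConfig E3 δ), -p.2)

set_option quotPrecheck false in
/-- The counting-measure kernel `S ↦ count|S`. -/
local notation "κ₀" => (⟨fun S : RootedHardCoreConfig E3 δ => (S.1 : LocalConfig E3).toMeasure,
  measurable_toMeasure (Fact.out : 0 < δ)⟩ : Kernel (RootedHardCoreConfig E3 δ) E3)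

set_option quotPrecheck false in
/-- The uniformly rooted empirical law `(1/N) ∑ᵢ δ_{x seen from xᵢ}` of a finite configuration on
the space of rooted `δ`-hard-core configurations. -/
local notation "emp[" N ", " x ", " hsep "]" =>
  (((N : ℕ) : ℝ≥0∞)⁻¹ • ∑ i : Fin N, (Measure.dirac (RootedHardCoreConfig.ofFinite x hsep i) :
    Measure (RootedHardCoreConfig E3 δ)))

/-! ### Sets of configurations closed under local approximation -/

/-- **Closure under local approximation is closedness in the local topology.** If a set `T` of
configurations contains every rooted `δ`-hard-core counting measure that is locally `(R, ε)`-matched by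
members of `T` at every scale, then its preimage under the counting-measure map `S ↦ count|S` is a
closed subset of the (metric) space of rooted `δ`-hard-core configurations: a limit `S` of a sequence
in the preimage is eventually `(R, ε)`-matched by the sequence (`LocalConfig.tendsto_iff_locallyMatches`).
[folklore] -/
theorem isClosed_preimage_toMeasure [Fact (0 < δ)] {T : Set (Measure E3)}
    (hT : ∀ μ : Measure E3, IsRootedHardCore δ μ →
      (∀ R ε : ℝ, 0 < ε → ∃ ν ∈ T, LocallyMatches R ε (atoms ν) (atoms μ)) → μ ∈ T) :
    IsClosed ((fun S : RootedHardCoreConfig E3 δ => (S.1 : LocalConfig E3).toMeasure) ⁻¹' T) := by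
  refine IsSeqClosed.isClosed fun u S hu hS => ?_
  refine hT _ ((isRootedHardCore_toMeasure_iff δ S.1).2 S.2) fun R ε hε => ?_
  have hS' : Tendsto (fun n => ((u n).1 : LocalConfig E3)) atTop (𝓝 (S.1 : LocalConfig E3)) :=
    (continuous_subtype_val.tendsto _).comp hS
  obtain ⟨n, hn⟩ := ((tendsto_iff_locallyMatches.1 hS') R ε hε).exists
  refine ⟨_, hu n, ?_⟩
  rw [atoms_toMeasure, atoms_toMeasure]
  exact hn.symm

/-- The counting measure of a finite configuration seen from its particle `i`, with the recentred
point set written as an image: `count|((· - xᵢ) '' range x)`. [folklore] -/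
theorem toMeasure_ofFinite_eq_image {N : ℕ} (x : Fin N → E3)
    (hsep : ∀ j k, j ≠ k → δ ≤ dist (x j) (x k)) (i : Fin N) :
    ((RootedHardCoreConfig.ofFinite x hsep i).1 : LocalConfig E3).toMeasure =
      (Measure.count : Measure E3).restrict ((fun z => z - x i) '' Set.range x) := by
  rw [RootedHardCoreConfig.toMeasure_ofFinite, ← Set.range_comp]
  rfl

/-! ### The limit along a `δ`-separated sequence -/

/-- **The Benjamini–Schramm limit along an arbitrary sequence of finite injective `δ`-separated
configurations** (`δ > 0` fixed, sizes `M n > 0`): a subsequence `φ` and a probability law `P` on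
`Measure ℝ³`, almost surely rooted `δ`-hard-core, point-stationary, with mean root energy
`lim_j 𝓔(y (φ j)) / M (φ j)`, and the closed-set half of the portmanteau theorem in density form for
sets of configurations closed under local approximation within the hard-core class.  The uniformly
rooted empirical laws on the compact metric space of rooted `δ`-hard-core configurations have a weakly
convergent subsequence (Prokhorov); exact finite mass transport passes to the limit; the root energy is
a continuous local functional and `E_{P_N}[h] = 𝓔/N` exactly; closed events pass to the limit by the
portmanteau theorem; the limit law is pushed to `Measure (Measure ℝ³)` along the measurable embedding
`S ↦ count|S`. [folklore] -/
theorem exists_limit_general [Fact (0 < δ)] (M : ℕ → ℕ) (y : (n : ℕ) → Fin (M n) → E3)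
    (hM : ∀ n, 0 < M n) (hy : ∀ n, Function.Injective (y n))
    (hsep : ∀ n, ∀ i j : Fin (M n), i ≠ j → δ ≤ dist (y n i) (y n j)) :
    ∃ φ : ℕ → ℕ, StrictMono φ ∧ ∃ P : Measure (Measure E3), IsProbabilityMeasure P ∧
      (∀ᵐ μ ∂P, IsRootedHardCore δ μ) ∧ IsPointStationaryLaw P ∧
      Tendsto (fun j : ℕ => interactionEnergy lennardJones (y (φ j)) / (M (φ j) : ℝ)) atTop
        (𝓝 (meanRootEnergy P)) ∧
      ∀ T : Set (Measure E3),
        (∀ μ : Measure E3, IsRootedHardCore δ μ →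
          (∀ R ε : ℝ, 0 < ε → ∃ ν ∈ T, LocallyMatches R ε (atoms ν) (atoms μ)) → μ ∈ T) →
        ∀ ρ : ℝ, (P T).toReal < ρ →
          ∀ᶠ j : ℕ in atTop, (Nat.card {i : Fin (M (φ j)) //
            ((Measure.count : Measure E3).restrict ((fun z => z - y (φ j) i) '' Set.range (y (φ j))))
              ∈ T} : ℝ) ≤ ρ * (M (φ j) : ℝ) := by
  have hδ : 0 < δ := Fact.out
  haveI : ∀ n, NeZero (M n) := fun n => ⟨(hM n).ne'⟩
  -- the empirical rooted laws on the compact metric space of rooted `δ`-hard-core configurations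
  have hprob : ∀ n : ℕ, IsProbabilityMeasure emp[M n, y n, hsep n] := fun n =>
    isProbabilityMeasure_emp
  set Qs : ℕ → ProbabilityMeasure (RootedHardCoreConfig E3 δ) := fun n =>
    ⟨emp[M n, y n, hsep n], hprob n⟩ with hQs_def
  -- Prokhorov: a weakly convergent subsequence
  obtain ⟨Q, ψ, hψ, hlim⟩ := CompactSpace.tendsto_subseq Qs
  set e : RootedHardCoreConfig E3 δ → Measure E3 := fun S => (S.1 : LocalConfig E3).toMeasure
    with he_def
  have hE : MeasurableEmbedding e := measurableEmbedding_toMeasure E3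
  haveI := isSFiniteKernel_toMeasure (E := E3) (δ := δ)
  have hinvN : ∀ n, ((Qs (ψ n) : Measure (RootedHardCoreConfig E3 δ)) ⊗ₘ κ₀).map Θ =
      (Qs (ψ n) : Measure (RootedHardCoreConfig E3 δ)) ⊗ₘ κ₀ := fun n =>
    map_reroot_compProd_emp (hy _)
  have hinv := map_reroot_compProd_eq_of_tendsto hlim hinvN
  refine ⟨ψ, hψ, (Q : Measure (RootedHardCoreConfig E3 δ)).map e,
    Measure.isProbabilityMeasure_map hE.measurable.aemeasurable, ?_, ?_, ?_, ?_⟩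
  · -- almost surely a rooted `δ`-hard-core counting measure
    exact (hE.ae_map_iff).2 (Eventually.of_forall fun S =>
      (isRootedHardCore_toMeasure_iff δ S.1).2 S.2)
  · -- point-stationarity
    exact isPointStationaryLaw_map_toMeasure hinv
  · -- the mean root energy
    show Tendsto _ atTop (𝓝 (∫ μ, (∫ z, lennardJones ‖z‖ ∂μ) / 2
      ∂(Q : Measure (RootedHardCoreConfig E3 δ)).map e))
    rw [hE.integral_map]
    set H : RootedHardCoreConfig E3 δ →ᵇ ℝ := BoundedContinuousFunction.mkOfCompact
      ⟨fun S => (∫ y, lennardJones ‖y‖ ∂((S.1 : LocalConfig E3).toMeasure)) / 2,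
        (continuous_integral_lennardJones_toMeasure hδ).div_const 2⟩ with hH_def
    have hlimH := (ProbabilityMeasure.tendsto_iff_forall_integral_tendsto.1 hlim) H
    refine (hlimH.congr fun j => ?_)
    change ∫ S, (∫ y, lennardJones ‖y‖ ∂((S.1 : LocalConfig E3).toMeasure)) / 2
      ∂emp[M (ψ j), y (ψ j), hsep (ψ j)] = _
    rw [integral_rootEnergy_emp (hy _)]
  · -- density transfer (portmanteau with closed sets)
    intro T hT ρ hρ
    have hF : IsClosed (e ⁻¹' T) := isClosed_preimage_toMeasure hT
    have hρ0 : 0 < ρ := ENNReal.toReal_nonneg.trans_lt hρ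
    -- portmanteau
    have hQF : (Q : Measure (RootedHardCoreConfig E3 δ)) (e ⁻¹' T) < ENNReal.ofReal ρ := by
      rw [← hE.map_apply]
      exact (ENNReal.lt_ofReal_iff_toReal_lt (measure_ne_top _ _)).2 hρ
    have hlimsup := ProbabilityMeasure.limsup_measure_closed_le_of_tendsto hlim hF
    have hev : ∀ᶠ j in atTop,
        (Qs (ψ j) : Measure (RootedHardCoreConfig E3 δ)) (e ⁻¹' T) < ENNReal.ofReal ρ :=
      eventually_lt_of_limsup_lt (hlimsup.trans_lt hQF)
    filter_upwards [hev] with j hj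
    -- counting
    change emp[M (ψ j), y (ψ j), hsep (ψ j)] (e ⁻¹' T) < ENNReal.ofReal ρ at hj
    rw [emp_apply hF.measurableSet, ENNReal.lt_ofReal_iff_toReal_lt
      (ENNReal.mul_ne_top (ENNReal.inv_ne_top.2 (Nat.cast_ne_zero.2 (hM _).ne'))
        (ENNReal.natCast_ne_top _)),
      ENNReal.toReal_mul, ENNReal.toReal_inv, ENNReal.toReal_natCast, ENNReal.toReal_natCast,
      inv_mul_eq_div, div_lt_iff₀ (Nat.cast_pos.2 (hM _))] at hj
    refine le_trans ?_ hj.le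
    have hsub : ∀ i : Fin (M (ψ j)),
        (Measure.count : Measure E3).restrict ((fun z => z - y (ψ j) i) '' Set.range (y (ψ j))) ∈ T →
        RootedHardCoreConfig.ofFinite (y (ψ j)) (hsep (ψ j)) i ∈ e ⁻¹' T := fun i hi => by
      rw [Set.mem_preimage, he_def]
      dsimp only
      rw [toMeasure_ofFinite_eq_image]
      exact hi
    rw [Nat.card_eq_fintype_card, Fintype.card_subtype]
    exact_mod_cast Finset.card_le_card (Finset.monotone_filter_right _ fun i _ hi => hsub i hi)

/-! ### The registered stub (`δ = 1/3`) -/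

/-- **Stub `stub_necessity_limit` (N1) of line `equilibrium-in-law-surgery` (reshape r6, necessity
sandwich) of crux `MinimiserShells` (stmt-AtomisticToContinuum-9225).**  The Benjamini–Schramm (local
weak) limit of an arbitrary sequence of finite injective `1/3`-separated configurations
`y n : Fin (M n) → ℝ³` (`M n > 0`): a subsequence `φ` and a probability law `P` on `Measure ℝ³`, almost
surely rooted `1/3`-hard-core, point-stationary, with mean root energy `lim_j 𝓔(y (φ j)) / M (φ j)`, and
the closed-set half of the portmanteau theorem in density form: for every set `T` of configurations
closed under local approximation within the hard-core class and every `ρ > P(T)`, eventually at most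
`ρ · M (φ j)` particles `i` of `y (φ j)` have re-rooted configuration `count|((· - y i) '' range y)` in
`T`.  Instance `δ = 1/3` of `exists_limit_general`. [folklore] -/
theorem stub_necessity_limit :
    ∀ (M : ℕ → ℕ) (y : (n : ℕ) → Fin (M n) → EuclideanSpace ℝ (Fin 3)),
      (∀ n, 0 < M n) → (∀ n, Function.Injective (y n)) →
      (∀ n, ∀ i j : Fin (M n), i ≠ j → (1 : ℝ) / 3 ≤ dist (y n i) (y n j)) →
      ∃ φ : ℕ → ℕ, StrictMono φ ∧ ∃ P : Measure (Measure (EuclideanSpace ℝ (Fin 3))), IsProbabilityMeasure P ∧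
        (∀ᵐ μ ∂P, IsRootedHardCore (1 / 3) μ) ∧ IsPointStationaryLaw P ∧
        Filter.Tendsto (fun j : ℕ => interactionEnergy lennardJones (y (φ j)) / (M (φ j) : ℝ)) Filter.atTop
          (nhds (meanRootEnergy P)) ∧
        ∀ T : Set (Measure (EuclideanSpace ℝ (Fin 3))),
          (∀ μ : Measure (EuclideanSpace ℝ (Fin 3)), IsRootedHardCore (1 / 3) μ →
            (∀ R ε : ℝ, 0 < ε → ∃ ν ∈ T, Literature.Probability.Process.LocallyMatches R ε
              (Literature.Probability.Process.atoms ν) (Literature.Probability.Process.atoms μ)) → μ ∈ T) →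
          ∀ ρ : ℝ, (P T).toReal < ρ →
            ∀ᶠ j : ℕ in Filter.atTop, (Nat.card {i : Fin (M (φ j)) //
              ((Measure.count : Measure (EuclideanSpace ℝ (Fin 3))).restrict ((fun z => z - y (φ j) i) '' Set.range (y (φ j)))) ∈ T} : ℝ) ≤ ρ * (M (φ j) : ℝ) := by
  intro M y hM hy hsep
  haveI : Fact (0 < (1 / 3 : ℝ)) := ⟨by norm_num⟩
  exact exists_limit_general M y hM hy hsep

end Summit.AtomisticToContinuum.Crystallization.Theorems.PalmUnimodularRigidityMinimiserShells.NecessityLimit
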